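import Summits.AtomisticToContinuum.FouriersLaw.Theses.CoercivePulse
import Summits.AtomisticToContinuum.FouriersLaw.Theorems.CoercivePulseLinearCeilingSpectralRepresentation
import Summits.AtomisticToContinuum.FouriersLaw.Theorems.CoercivePulseLinearCeilingHelfandMoment
import Summits.AtomisticToContinuum.FouriersLaw.Theorems.CoercivePulseLinearCeilingEnvelopeOfSpectralAbelBound
import Summits.AtomisticToContinuum.FouriersLaw.Theorems.CoercivePulsePulseCalculus
import Summits.AtomisticToContinuum.FouriersLaw.Theorems.LinearCeiling.Negative.LinearCeilingShiftCovarianceDerivable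
import HarnessLib

/-!
# `CoercivePulse.LinearCeiling` ⇔ the infinite-volume Abel ceiling of `C_T` (item stmt-AtomisticToContinuum-15383)

Line `SpikeLemma`, lead c1 (2026-08-17). The crux `LinearCeiling` (anchored at-most-linear upper envelope of the
Helfand moment `M(t) = Σ_x x² S(x,t)` of the averaged equilibrium energy pulse of the pinned anharmonic chain, for
every guarded pair `(μ, D)`) is EQUIVALENT, over landed theorems only, to the **infinite-volume Abel ceiling**

  (AC)  for every guarded pair, `∃ B ν₀ > 0, ∀ ν ∈ (0, ν₀), ∫₀^∞ e^{-νt} C_T(t) dt ≤ B`,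

`C_T = D.currentCorrelation μ` the summed current autocorrelation entering the Green–Kubo formula:

* (AC) ⇒ `LinearCeiling` (`linearCeiling_of_abelCeiling`): cosine-Bochner representation of `C_T`
  (`stub_spectralRepresentation`), the kernel comparison `2∫₀ᵗ(t−u)C_T = 2∫(1 − cos ωt)/ω² dσ ≤ b·t`
  (`stub_envelopeOfSpectralAbelBound`) and Helfand's identity `M(t) − M(0) = 2∫₀ᵗ(t−u)C_T` (`stub_helfandMoment`);
  anchor `t₃ = 0`.
* `LinearCeiling` ⇒ (AC) (`abelCeiling_of_linearCeiling`): the PROVED item `PulseCalculus` (stmt-15385: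
  continuity of `M`, Helfand's identity in Laplace form `∫₀^∞e^{−νt}C_T = (ν²/2)∫₀^∞e^{−νt}(M(t)−M(0))dt`) and the
  explicit Laplace integrals `∫₀^∞e^{−νt}dt = 1/ν`, `∫₀^∞te^{−νt}dt = 1/ν²` give `Â(ν) ≤ |b|/2 + C₃ν/2`; the a.e.
  shift-covariance of the guard is derivable (`Negative.shiftCovariant_of_preservesMeasure`).

So the crux is EXACTLY the statement "limsup_{ν↓0} of the Abelian Green–Kubo means is finite" (no convergence, no rate):
the finiteness half of the conductivity of the infinite pinned anharmonic chain in its weakest Abelian form. Every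
supplier of (AC) closes the crux: the route's own (R) (`stub_abelMeanCeiling`, landed), or the window pair
`LatticeLandauDamping.WindowDecomposition ∧ NoDrudeWeight` (file `CoercivePulseLinearCeilingOfWindowDecomposition`).

[cite: Helfand1960, §II] [cite: BonettoLebowitzReyBellet2000, §7 eq. (37)] [cite: Widder1941, Ch. V §1]
-/

noncomputable section

namespace Summit.AtomisticToContinuum.FouriersLaw.Theorems.LinearCeiling.SpikeLemma

open MeasureTheory Filter Set
open scoped Topology BigOperators
open Literature.MathematicalPhysics.KineticTheory.HeatConduction
open Summit.AtomisticToContinuum.FouriersLaw.Theses.CoercivePulse (LinearCeiling PulseCalculus)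

/-- **(AC) ⇒ `LinearCeiling`.** If the Abel means `∫₀^∞ e^{−νt} C_T(t) dt` of the summed current autocorrelation of
every guarded pair `(μ, D)` of the pinned anharmonic chain are bounded above on some `(0, ν₀)`, then the Helfand moment
of the averaged energy pulse of every guarded pair has the anchored linear upper envelope `M(t) ≤ M(0) + b·t`
(`t ≥ 0`). The weakest sufficient hypothesis of line `SpikeLemma` (cosine Bochner + Fejér/Abel kernel comparison +
Helfand). [cite: Helfand1960, §II] -/
theorem linearCeiling_of_abelCeiling
    (hAC : ∀ ω₂ lam β γ : ℝ, 0 < ω₂ → 0 < lam → 0 < β → ∀ T : ℝ, 0 < T →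
      ∀ μ : MeasureTheory.Measure ChainConfig, (pinnedChain ω₂ lam β γ).IsChainGibbsMeasure T μ →
      IsShiftInvariant μ → μ.map (fun σ : ChainConfig => fun x : ℤ => ((σ x).1, -(σ x).2)) = μ →
      ∀ D : InfiniteChainDynamics (pinnedChain ω₂ lam β γ), D.PreservesMeasure μ →
      ∃ B ν₀ : ℝ, 0 < ν₀ ∧ ∀ ν : ℝ, 0 < ν → ν < ν₀ →
        ∫ t in Set.Ioi (0:ℝ), Real.exp (-(ν * t)) * D.currentCorrelation μ t ≤ B) :
    LinearCeiling := by
  intro ω₂ lam β γ hω hl hβ T hT μ hG hSI hRv D hP hSh h hh S hS hSum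
  obtain ⟨B, ν₀, hν₀, hA⟩ := hAC ω₂ lam β γ hω hl hβ T hT μ hG hSI hRv D hP
  obtain ⟨σ, hσ, hC⟩ := stub_spectralRepresentation ω₂ lam β γ hω hl hβ T hT μ hG hSI hRv D hP
  obtain ⟨b, hb⟩ := stub_envelopeOfSpectralAbelBound σ hσ _ hC B ν₀ hν₀ hA
  refine ⟨b, 0, fun t ht => ?_⟩
  rcases eq_or_lt_of_le ht with h0 | h0
  · subst h0
    simp
  · have hH := stub_helfandMoment ω₂ lam β γ hω hl hβ T hT μ hG hSI hRv D hP hSh h hh S hS hSum t h0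
    have hbt := hb t ht
    rw [sub_zero]
    linarith

/-- **Upper half of the Abelian sandwich (pure real analysis).** If `M` is continuous with an anchored linear upper
envelope `M(t) ≤ M(t₃) + b(t − t₃)` for `t ≥ t₃`, and `A(ν) = (ν²/2)∫₀^∞ e^{−νt}(M(t) − M(0)) dt` with an integrable
integrand, then `A(ν) ≤ |b|/2 + C₃ν/2` for every `ν > 0`, for some `C₃ ≥ 0`
(`∫₀^∞e^{−νt}dt = 1/ν`, `∫₀^∞te^{−νt}dt = 1/ν²`; the proof of the deciding theorem `CoercivePulse.closes`, upper half).
[cite: Widder1941, Ch. V §1] -/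
theorem abelMean_le_of_linearEnvelope (A M : ℝ → ℝ) (b t₃ : ℝ) (hMc : Continuous M)
    (hup : ∀ t, t₃ ≤ t → M t ≤ M t₃ + b * (t - t₃))
    (hint : ∀ ν, 0 < ν → IntegrableOn (fun t => Real.exp (-(ν * t)) * (M t - M 0)) (Ioi 0))
    (hA : ∀ ν, 0 < ν → A ν = ν ^ 2 / 2 * ∫ t in Ioi (0:ℝ), Real.exp (-(ν * t)) * (M t - M 0)) :
    ∃ C₃ : ℝ, 0 ≤ C₃ ∧ ∀ ν, 0 < ν → A ν ≤ |b| / 2 + C₃ / 2 * ν := by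
  have hE0 : ∀ ν : ℝ, 0 < ν → IntegrableOn (fun t => Real.exp (-(ν * t))) (Ioi 0) ∧
      ∫ t in Ioi (0:ℝ), Real.exp (-(ν * t)) = ν⁻¹ := fun ν hν => by
    refine ⟨by simpa only [neg_mul] using exp_neg_integrableOn_Ioi 0 hν, ?_⟩
    rw [show (fun t : ℝ => Real.exp (-(ν * t))) = fun t => Real.exp (-ν * t) from
        funext fun t => by rw [neg_mul],
      integral_exp_mul_Ioi (neg_lt_zero.mpr hν) 0, mul_zero, Real.exp_zero, neg_div, one_div, inv_neg, neg_neg]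
  have hE1 : ∀ ν : ℝ, 0 < ν → IntegrableOn (fun t => Real.exp (-(ν * t)) * t) (Ioi 0) ∧
      ∫ t in Ioi (0:ℝ), Real.exp (-(ν * t)) * t = (ν ^ 2)⁻¹ := fun ν hν => by
    have h := Real.integral_rpow_mul_exp_neg_mul_Ioi (a := 2) (r := ν) (by norm_num) hν
    rw [Real.Gamma_two, mul_one, Real.rpow_two, one_div, inv_pow] at h
    have hv : ∫ t in Ioi (0:ℝ), Real.exp (-(ν * t)) * t = (ν ^ 2)⁻¹ :=
      (setIntegral_congr_fun measurableSet_Ioi fun t _ => by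
        rw [show (2:ℝ) - 1 = 1 by norm_num, Real.rpow_one, mul_comm]).trans h
    exact ⟨Integrable.of_integral_ne_zero (by rw [hv]; positivity), hv⟩
  obtain ⟨T, h3, h0⟩ : ∃ T : ℝ, t₃ ≤ T ∧ 0 ≤ T := ⟨max t₃ 0, le_max_left _ _, le_max_right _ _⟩
  obtain ⟨K, hK⟩ : ∃ K : ℝ, ∀ t ∈ Icc 0 T, |M t - M 0| ≤ K := by
    obtain ⟨C, hC⟩ := (isCompact_Icc (a := (0:ℝ)) (b := T)).exists_bound_of_continuousOn
      ((hMc.sub continuous_const).continuousOn (s := Icc 0 T))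
    exact ⟨C, fun t ht => by simpa only [Real.norm_eq_abs, Pi.sub_apply] using hC t ht⟩
  have hK0 : 0 ≤ K := (abs_nonneg _).trans (hK 0 ⟨le_rfl, h0⟩)
  -- global bound `M t − M 0 ≤ |b| t + C₃` on `(0, ∞)`
  obtain ⟨C₃, hC₃, hhi⟩ : ∃ C₃ : ℝ, 0 ≤ C₃ ∧ ∀ t : ℝ, 0 < t → M t - M 0 ≤ |b| * t + C₃ := by
    refine ⟨K + |M t₃ - M 0| + |b| * |t₃|, by positivity, fun t ht => ?_⟩
    rcases le_or_gt T t with hT | hT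
    · have e1 := hup t (h3.trans hT)
      have e2 : b * (t - t₃) ≤ |b| * t + |b| * |t₃| := by
        have := le_abs_self (b * (t - t₃)); have := abs_sub t t₃
        rw [abs_mul] at *; rw [abs_of_pos ht] at *; nlinarith [abs_nonneg b]
      linarith [le_abs_self (M t₃ - M 0)]
    · have := (le_abs_self _).trans (hK t ⟨ht.le, hT.le⟩)
      nlinarith [abs_nonneg (M t₃ - M 0), abs_nonneg b, abs_nonneg t₃]
  refine ⟨C₃, hC₃, fun ν hν => ?_⟩
  obtain ⟨hi0, hv0⟩ := hE0 ν hν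
  obtain ⟨hi1, hv1⟩ := hE1 ν hν
  have iU : IntegrableOn (fun t => Real.exp (-(ν * t)) * (|b| * t + C₃)) (Ioi 0) ∧
      ∫ t in Ioi (0:ℝ), Real.exp (-(ν * t)) * (|b| * t + C₃) = |b| * (ν ^ 2)⁻¹ + C₃ * ν⁻¹ := by
    have e : (fun t : ℝ => Real.exp (-(ν * t)) * (|b| * t + C₃)) =
        fun t => |b| * (Real.exp (-(ν * t)) * t) + C₃ * Real.exp (-(ν * t)) := funext fun t => by ring
    rw [e]
    exact ⟨(hi1.const_mul |b|).add (hi0.const_mul C₃), by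
      rw [integral_add (hi1.const_mul |b|) (hi0.const_mul C₃), integral_const_mul, integral_const_mul,
        hv1, hv0]⟩
  have cU := setIntegral_mono_on (hint ν hν) iU.1 measurableSet_Ioi
    fun t ht => mul_le_mul_of_nonneg_left (hhi t ht) (Real.exp_pos (-(ν * t))).le
  rw [iU.2] at cU
  have f2 : ν ^ 2 / 2 * (|b| * (ν ^ 2)⁻¹ + C₃ * ν⁻¹) = |b| / 2 + C₃ / 2 * ν := by field_simp
  rw [hA ν hν]
  exact f2 ▸ mul_le_mul_of_nonneg_left cU (by positivity)

/-- **`LinearCeiling` ⇒ (AC).** The diffusive upper envelope of the Helfand moment (`CoercivePulse.LinearCeiling`,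
item stmt-AtomisticToContinuum-15383) implies that the Abel means of the summed current autocorrelation of every
guarded pair are bounded above on `(0, 1)`: the PROVED pulse calculus (`pulseCalculus_proof`: summability of the pulse,
continuity of `M`, Helfand's identity in Laplace form) feeds the upper half of the Abelian sandwich
(`abelMean_le_of_linearEnvelope`); the a.e. shift-covariance of the guard is derivable
(`Negative.shiftCovariant_of_preservesMeasure`). [cite: Helfand1960, §II] [cite: BonettoLebowitzReyBellet2000, §7 eq. (37)] -/
theorem abelCeiling_of_linearCeiling (hLC : LinearCeiling) :
    ∀ ω₂ lam β γ : ℝ, 0 < ω₂ → 0 < lam → 0 < β → ∀ T : ℝ, 0 < T →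
      ∀ μ : MeasureTheory.Measure ChainConfig, (pinnedChain ω₂ lam β γ).IsChainGibbsMeasure T μ →
      IsShiftInvariant μ → μ.map (fun σ : ChainConfig => fun x : ℤ => ((σ x).1, -(σ x).2)) = μ →
      ∀ D : InfiniteChainDynamics (pinnedChain ω₂ lam β γ), D.PreservesMeasure μ →
      ∃ B ν₀ : ℝ, 0 < ν₀ ∧ ∀ ν : ℝ, 0 < ν → ν < ν₀ →
        ∫ t in Set.Ioi (0:ℝ), Real.exp (-(ν * t)) * D.currentCorrelation μ t ≤ B := by
  intro ω₂ lam β γ hω hl hβ T hT μ hG hSI hRv D hP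
  have hSh : ∀ t : ℝ, ∀ᵐ σ ∂μ, D.flow t (shift σ) = shift (D.flow t σ) := fun t =>
    Summit.AtomisticToContinuum.FouriersLaw.Theorems.LinearCeiling.Negative.shiftCovariant_of_preservesMeasure
      hω hl hβ hT hG hSI D hP t
  -- the pulse objects, generalised
  obtain ⟨h, hh⟩ : ∃ h : ChainConfig → ℤ → ℝ, h = (fun (σ : ChainConfig) (x : ℤ) => (σ x).2 ^ 2 / 2 +
      (pinnedChain ω₂ lam β γ).U (σ x).1 + ((pinnedChain ω₂ lam β γ).V ((σ (x + 1)).1 - (σ x).1) +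
      (pinnedChain ω₂ lam β γ).V ((σ x).1 - (σ (x - 1)).1)) / 2) := ⟨_, rfl⟩
  obtain ⟨S, hS⟩ : ∃ S : ℤ → ℝ → ℝ, S = (fun (x : ℤ) (t : ℝ) =>
      ∫ σ, (h σ 0 - ∫ σ', h σ' 0 ∂μ) * (h (D.flow t σ) x - ∫ σ', h σ' 0 ∂μ) ∂μ) := ⟨_, rfl⟩
  obtain ⟨-, -, hSum, hMc, hHL⟩ :=
    Summit.AtomisticToContinuum.FouriersLaw.Theorems.PulseCalculus.CanonicalReduction.pulseCalculus_proof
      ω₂ lam β γ hω hl hβ T hT μ hG hSI hRv D hP hSh h hh S hS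
  obtain ⟨b, t₃, hup⟩ := hLC ω₂ lam β γ hω hl hβ T hT μ hG hSI hRv D hP hSh h hh S hS hSum
  obtain ⟨C₃, hC₃, hle⟩ := abelMean_le_of_linearEnvelope
    (fun ν => ∫ t in Set.Ioi (0:ℝ), Real.exp (-(ν * t)) * D.currentCorrelation μ t)
    (fun t => ∑' x : ℤ, (x : ℝ) ^ 2 * S x t) b t₃ hMc hup (fun ν hν => (hHL ν hν).1) (fun ν hν => (hHL ν hν).2)
  refine ⟨|b| / 2 + C₃ / 2, 1, one_pos, fun ν hν hν1 => ?_⟩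
  have h1 := hle ν hν
  have h2 : C₃ / 2 * ν ≤ C₃ / 2 := by
    have := mul_le_mul_of_nonneg_left hν1.le (by positivity : 0 ≤ C₃ / 2)
    simpa only [mul_one] using this
  exact h1.trans (by linarith)

/-- **`LinearCeiling` ⇔ (AC)** — the crux of route `CoercivePulse` is exactly the infinite-volume Abel ceiling of the
summed current autocorrelation of the guarded pairs (finiteness of `limsup_{ν↓0}` of the Abelian Green–Kubo means,
without convergence and without rate). [cite: Helfand1960, §II] -/
theorem linearCeiling_iff_abelCeiling :
    LinearCeiling ↔
    (∀ ω₂ lam β γ : ℝ, 0 < ω₂ → 0 < lam → 0 < β → ∀ T : ℝ, 0 < T →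
      ∀ μ : MeasureTheory.Measure ChainConfig, (pinnedChain ω₂ lam β γ).IsChainGibbsMeasure T μ →
      IsShiftInvariant μ → μ.map (fun σ : ChainConfig => fun x : ℤ => ((σ x).1, -(σ x).2)) = μ →
      ∀ D : InfiniteChainDynamics (pinnedChain ω₂ lam β γ), D.PreservesMeasure μ →
      ∃ B ν₀ : ℝ, 0 < ν₀ ∧ ∀ ν : ℝ, 0 < ν → ν < ν₀ →
        ∫ t in Set.Ioi (0:ℝ), Real.exp (-(ν * t)) * D.currentCorrelation μ t ≤ B) :=
  ⟨abelCeiling_of_linearCeiling, linearCeiling_of_abelCeiling⟩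

end Summit.AtomisticToContinuum.FouriersLaw.Theorems.LinearCeiling.SpikeLemma

end
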